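import Literature.Probability.RandomPlanarGeometry.BDGS2012GrahamPieces
import HarnessLib

/-!
# Graham's Borel-type bound for `z_c(d)` (BDGS 2012, (1.20)), VI: the generating-function
# estimate for lace graphs with short pieces (Graham 2010, §6, the term `A₃`)

Sibling file of `Literature.Probability.RandomPlanarGeometry.BDGS2012` (fact
`BDGS2012_Graham_criticalPoint_bound` = Graham 2010, Theorem 1), sequel to
`BDGS2012GrahamPieces.lean` (`z^a · diagTotalLe d a M K ≤ cpow f (M+1) a`, Lemma 7).

## What the source prints (Graham 2010, §6, the estimate of `A₃`)

"Let `A₃` match the terms generated … by lace graphs of length `a ≥ 2M` and type `N ≤ M` …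
By Lemma 7, `|A₃| ≤ Σ_{N=1}^{M} Σ_{a=2M}^{2MN} β_τ^a [β^a](Σ_{n=1}^{M} C₄ⁿ s^{-n} n! β^{2n}(1+s/β))^N`
… Setting `x = β²` … We can assume that `(1+s/β_τ)C₄Mβ_τ²s⁻¹ ≤ C₆e⁻¹Ms ≤ 1`. The above is less
than `Σ_N Σ_{a=M}^{MN} (C₆e⁻¹Ms)^a [x^a](Σ_{n=1}^{M} xⁿ n!/Mⁿ)^N ≤ (C₆e⁻¹Ms)^M Σ_N (Σ_n n!/Mⁿ)^N
≤ ¼ s^M C₆^{M+1}(M+1)!`"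

At infinite memory the pieces are not bounded by the memory `τ = 2M` but by the truncation
`K₀` (a multiple of `d`), so besides Graham's "short" pieces (`k ≤ 2M`, handled by his rescaling
`x = β²·(scale)`, here the Chernoff parameter `ρ`) there are "medium" pieces `2M < k ≤ K₀`, each of
which alone carries the factor `B^{M+1}(M+1)! s^{M+1}`; this file proves the resulting bound for
an ABSTRACT coefficient sequence `f` (the piece generating function) under the factorial bound
`f(k) ≤ Γ B^m m! s^m`, `m = ⌈k/2⌉`, which is how Lemma 7's `C₄ⁿ s⁻ⁿ n! β^{2n}(1 + s/β)` reads after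
`β ≤ (1+γ/d)s`.

## What is formalised (namespace `Literature.Probability.RandomPlanarGeometry.SAW.Zd.Graham2010`)

* `cpow` algebra: `cpow_mul_pow` (rescaling `f(k)ρ^k`), `cpow_eq_zero_of_lt` (support),
  `sum_cpow_eq_pow` (total mass `Σ_a cpow f N a = (Σ_k f k)^N`), `cpow_mono`,
  `pow_sub_pow_le` (`x^N - y^N ≤ N(x-y)x^{N-1}`);
* the factorial-geometric bookkeeping `factorial_le_pow_of_le` (`m! ≤ M^m`, `m ≤ M`) and
  `pow_factorial_pow_le` (`B^m m! s^m ≤ B^{m₀} m₀! s^{m₀} 2^{m₀-m}` when `B j s ≤ ½` for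
  `m₀ < j ≤ m`);
* **`sum_cpow_short_le`** (Graham's rescaling): if `f` vanishes off `[1, 2M]` and
  `f(k) ≤ Γ B^m m! s^m` then `Σ_{a ≥ 2M} cpow f N a ≤ (24ΓB)^M M! s^M` whenever `8ΓB·M·s ≤ 1`;
* **`sum_cpow_sub_le`** (medium pieces): `Σ_a (cpow f N a - cpow f_s N a) ≤ N·F_m·F_all^{N-1}`,
  and `sum_tail_le` (`Σ_{k>2M₀} f k ≤ 4Γ B^{M₀+1}(M₀+1)! s^{M₀+1}` when `B(K₀+2)s ≤ 1`);
* **`shortPieces_bound`**: for `f` vanishing off `[1, K₀]` with the factorial bound, `8ΓB·M·s ≤ 1`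
  and `B(K₀ + 2)s ≤ 1`:
  `Σ_{a=2M}^{hi} cpow f N a ≤ (24ΓB)^M M! s^M + 4NΓ B^{M+1}(M+1)! s^{M+1}` for `1 ≤ N`, and the
  sum over the types `N ≤ M`: `sum_shortPieces_bound`, `≤ (48ΓB)^{M+1}(M+1)! s^M`.

Not here: the instantiation `f(k) = (k+1)Q(k)z^k` (next file) and the long pieces.
-/

noncomputable section

open Finset
open scoped BigOperators

namespace Literature.Probability.RandomPlanarGeometry.SAW.Zd.Graham2010

/-! ### `cpow` algebra -/

/-- Rescaling: `[s^a](Σ f_k ρ^k s^k)^N = ρ^a [s^a](Σ f_k s^k)^N`. [folklore] -/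
theorem cpow_mul_pow (f : ℕ → ℝ) (ρ : ℝ) : ∀ N a : ℕ, cpow (fun k => f k * ρ ^ k) N a = ρ ^ a * cpow f N a := by
  intro N
  induction N with
  | zero => intro a; rw [cpow_zero, cpow_zero]; split_ifs with h <;> simp [h]
  | succ N ih =>
    intro a
    rw [cpow_succ, cpow_succ, Finset.mul_sum]
    refine Finset.sum_congr rfl fun k hk => ?_
    rw [Finset.mem_range] at hk
    rw [ih k]
    have : ρ ^ a = ρ ^ k * ρ ^ (a - k) := by rw [← pow_add]; congr 1; omega
    rw [this]; ring

/-- Support: if `f` vanishes beyond `K` then `cpow f N a = 0` for `a > N K`. [folklore] -/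
theorem cpow_eq_zero_of_lt {f : ℕ → ℝ} {K : ℕ} (hf : ∀ k, K < k → f k = 0) :
    ∀ N a : ℕ, N * K < a → cpow f N a = 0 := by
  intro N
  induction N with
  | zero => intro a ha; rw [cpow_zero, if_neg (by omega)]
  | succ N ih =>
    intro a ha
    rw [cpow_succ]
    refine Finset.sum_eq_zero fun k hk => ?_
    rw [Finset.mem_range] at hk
    by_cases h : N * K < k
    · rw [ih k h, zero_mul]
    · have h' : k ≤ N * K := Nat.le_of_not_lt h
      have ha' : N * K + K < a := by rw [Nat.succ_mul] at ha; exact ha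
      rw [hf (a - k) (by omega), mul_zero]

/-- The triangle swap `Σ_{a ≤ L} Σ_{k ≤ a} F k (a - k) = Σ_{j ≤ L} Σ_{k ≤ L - j} F k j`. [folklore] -/
theorem sum_range_sum_range_swap {R : Type*} [AddCommMonoid R] (F : ℕ → ℕ → R) (L : ℕ) :
    ∑ a ∈ Finset.range (L + 1), ∑ k ∈ Finset.range (a + 1), F k (a - k) =
      ∑ j ∈ Finset.range (L + 1), ∑ k ∈ Finset.range (L + 1 - j), F k j := by
  rw [Finset.sum_sigma', Finset.sum_sigma']
  refine Finset.sum_nbij' (fun p => ⟨p.1 - p.2, p.2⟩) (fun q => ⟨q.1 + q.2, q.2⟩) ?_ ?_ ?_ ?_ ?_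
  · rintro ⟨a, k⟩ h
    simp only [Finset.mem_sigma, Finset.mem_range] at h ⊢
    omega
  · rintro ⟨j, k⟩ h
    simp only [Finset.mem_sigma, Finset.mem_range] at h ⊢
    omega
  · rintro ⟨a, k⟩ h
    simp only [Finset.mem_sigma, Finset.mem_range] at h
    simp only [Sigma.mk.inj_iff, heq_eq_eq, and_true]
    omega
  · rintro ⟨j, k⟩ h
    simp only [Sigma.mk.inj_iff, heq_eq_eq, and_true]
    omega
  · rintro ⟨a, k⟩ _
    rfl

/-- **Total mass**: if `f` vanishes beyond `K` then `Σ_{a ≤ L} cpow f N a = (Σ_{k ≤ K} f k)^N` for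
`L ≥ N K`. [folklore] -/
theorem sum_cpow_eq_pow {f : ℕ → ℝ} {K : ℕ} (hf : ∀ k, K < k → f k = 0) :
    ∀ N L : ℕ, N * K ≤ L → ∑ a ∈ Finset.range (L + 1), cpow f N a = (∑ k ∈ Finset.range (K + 1), f k) ^ N := by
  have hsumK : ∀ L', K ≤ L' → ∑ k ∈ Finset.range (L' + 1), f k = ∑ k ∈ Finset.range (K + 1), f k := by
    intro L' hL'
    symm
    refine Finset.sum_subset (Finset.range_subset_range.2 (by omega)) fun k hk hk' => ?_
    rw [Finset.mem_range] at hk hk'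
    exact hf k (by omega)
  intro N
  induction N with
  | zero =>
    intro L _
    rw [pow_zero]
    simp_rw [cpow_zero]
    rw [Finset.sum_ite_eq' (Finset.range (L + 1)) 0 (fun _ => (1 : ℝ)), if_pos (by simp)]
  | succ N ih =>
    intro L hL
    simp_rw [cpow_succ]
    rw [sum_range_sum_range_swap (fun k j => cpow f N k * f j) L]
    -- `Σ_{j ≤ L} f j · Σ_{k ≤ L-j} cpow f N k`
    have hinner : ∀ j ∈ Finset.range (L + 1), ∑ k ∈ Finset.range (L + 1 - j), cpow f N k * f j =
        f j * (∑ k ∈ Finset.range (K + 1), f k) ^ N := by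
      intro j hj
      rw [Finset.mem_range] at hj
      by_cases hjK : K < j
      · rw [hf j hjK]; simp
      · have hjK' : j ≤ K := Nat.le_of_not_lt hjK
        rw [← Finset.sum_mul, mul_comm]
        congr 1
        have hLj : N * K ≤ L - j := by
          have : N * K + K ≤ L := by rw [Nat.succ_mul] at hL; exact hL
          omega
        rw [show L + 1 - j = (L - j) + 1 by omega]
        exact ih (L - j) hLj
    rw [Finset.sum_congr rfl hinner, ← Finset.sum_mul,
      hsumK L (le_trans (Nat.le_mul_of_pos_left K (Nat.succ_pos N)) hL), pow_succ, mul_comm]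

/-- Monotonicity of `cpow` in the coefficients. [folklore] -/
theorem cpow_mono {f g : ℕ → ℝ} (hf : ∀ k, 0 ≤ f k) (hfg : ∀ k, f k ≤ g k) (N a : ℕ) :
    cpow f N a ≤ cpow g N a := by
  have h1 : |cpow f N a| ≤ cpow g N a :=
    abs_cpow_le (m := a) (fun i _ => by rw [abs_of_nonneg (hf i)]; exact hfg i) N a le_rfl
  exact (le_abs_self _).trans h1

/-- `cpow` of nonnegative coefficients is nonnegative. [folklore] -/
theorem cpow_nonneg' {f : ℕ → ℝ} (hf : ∀ k, 0 ≤ f k) (N a : ℕ) : 0 ≤ cpow f N a :=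
  cpow_nonneg (m := a) (fun i _ => hf i) N a le_rfl

/-- `x^N - y^N ≤ N (x - y) x^{N-1}` for `0 ≤ y ≤ x`. [folklore] -/
theorem pow_sub_pow_le {x y : ℝ} (hy : 0 ≤ y) (hyx : y ≤ x) :
    ∀ N : ℕ, x ^ N - y ^ N ≤ N * (x - y) * x ^ (N - 1) := by
  intro N
  induction N with
  | zero => simp
  | succ N ih =>
    have hx : 0 ≤ x := hy.trans hyx
    have hyN : y ^ N ≤ x ^ N := pow_le_pow_left₀ hy hyx N
    rw [Nat.add_sub_cancel]
    rcases N with _ | N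
    · simp
    · rw [Nat.add_sub_cancel] at ih
      have e1 : x ^ (N + 1 + 1) - y ^ (N + 1 + 1) = x * (x ^ (N + 1) - y ^ (N + 1)) + (x - y) * y ^ (N + 1) := by
        ring
      rw [e1]
      have h2 : (x - y) * y ^ (N + 1) ≤ (x - y) * x ^ (N + 1) :=
        mul_le_mul_of_nonneg_left hyN (by linarith)
      have h3 : x * (x ^ (N + 1) - y ^ (N + 1)) ≤ x * ((N + 1 : ℕ) * (x - y) * x ^ N) :=
        mul_le_mul_of_nonneg_left ih hx
      calc x * (x ^ (N + 1) - y ^ (N + 1)) + (x - y) * y ^ (N + 1)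
          ≤ x * ((N + 1 : ℕ) * (x - y) * x ^ N) + (x - y) * x ^ (N + 1) := add_le_add h3 h2
        _ = ((N + 1 + 1 : ℕ) : ℝ) * (x - y) * x ^ (N + 1) := by push_cast; ring

/-! ### Factorial-geometric bookkeeping -/

/-- `m! ≤ M^m` for `m ≤ M`. [folklore] -/
theorem factorial_le_pow_of_le {m M : ℕ} (h : m ≤ M) : (m.factorial : ℝ) ≤ (M : ℝ) ^ m := by
  have : m.factorial ≤ M ^ m := by
    induction m with
    | zero => simp
    | succ m ih =>
      rw [Nat.factorial_succ, pow_succ, mul_comm]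
      exact Nat.mul_le_mul (ih (Nat.le_of_succ_le h)) h
  exact_mod_cast this

/-- Geometric decay of the factorial terms past `m₀`: if `B j s ≤ ½` for `m₀ < j ≤ m` then
`B^m m! s^m ≤ B^{m₀} m₀! s^{m₀} (½)^{m - m₀}`. [folklore] -/
theorem pow_factorial_pow_le {B s : ℝ} (hB : 0 ≤ B) (hs : 0 ≤ s) (m₀ : ℕ) :
    ∀ m : ℕ, m₀ ≤ m → (∀ j : ℕ, m₀ < j → j ≤ m → B * j * s ≤ 1 / 2) →
      B ^ m * (m.factorial : ℝ) * s ^ m ≤ B ^ m₀ * (m₀.factorial : ℝ) * s ^ m₀ * (1 / 2 : ℝ) ^ (m - m₀) := by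
  intro m hm hj
  induction m with
  | zero =>
    have : m₀ = 0 := by omega
    subst this; simp
  | succ m ih =>
    rcases Nat.eq_or_lt_of_le hm with rfl | hlt
    · simp
    · have h1 := ih (by omega) (fun j h1 h2 => hj j h1 (by omega))
      have h2 : B * (m + 1 : ℕ) * s ≤ 1 / 2 := hj (m + 1) (by omega) le_rfl
      have hnn : 0 ≤ B ^ m * (m.factorial : ℝ) * s ^ m := by positivity
      calc B ^ (m + 1) * ((m + 1).factorial : ℝ) * s ^ (m + 1)
          = (B * (m + 1 : ℕ) * s) * (B ^ m * (m.factorial : ℝ) * s ^ m) := by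
            rw [Nat.factorial_succ, Nat.cast_mul, pow_succ, pow_succ]; ring
        _ ≤ (1 / 2 : ℝ) * (B ^ m₀ * (m₀.factorial : ℝ) * s ^ m₀ * (1 / 2 : ℝ) ^ (m - m₀)) :=
            mul_le_mul h2 h1 hnn (by norm_num)
        _ = B ^ m₀ * (m₀.factorial : ℝ) * s ^ m₀ * (1 / 2 : ℝ) ^ (m + 1 - m₀) := by
            rw [show m + 1 - m₀ = (m - m₀) + 1 by omega, pow_succ]; ring

/-- `Σ_{k<n} (½)^{k+1} ≤ 1`. [folklore] -/
theorem sum_half_pow_succ_le (n : ℕ) : ∑ k ∈ Finset.range n, (1 / 2 : ℝ) ^ (k + 1) ≤ 1 := by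
  have : ∑ k ∈ Finset.range n, (1 / 2 : ℝ) ^ (k + 1) = 1 - (1 / 2 : ℝ) ^ n := by
    induction n with
    | zero => simp
    | succ n ih => rw [Finset.sum_range_succ, ih, pow_succ]; ring
  rw [this]
  have : (0 : ℝ) ≤ (1 / 2 : ℝ) ^ n := by positivity
  linarith

/-- `Σ_{i<n} (½)^{⌊i/2⌋} ≤ 4` (two copies of a geometric series). [folklore] -/
theorem sum_half_pow_div_two_le (n : ℕ) : ∑ i ∈ Finset.range n, (1 / 2 : ℝ) ^ (i / 2) ≤ 4 := by
  have key : ∀ j : ℕ, ∑ i ∈ Finset.range (2 * j), (1 / 2 : ℝ) ^ (i / 2) = 4 - 4 * (1 / 2 : ℝ) ^ j ∧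
      ∑ i ∈ Finset.range (2 * j + 1), (1 / 2 : ℝ) ^ (i / 2) = 4 - 3 * (1 / 2 : ℝ) ^ j := by
    intro j
    induction j with
    | zero => norm_num
    | succ j ih =>
      obtain ⟨h1, h2⟩ := ih
      have e1 : 2 * (j + 1) = (2 * j + 1) + 1 := by ring
      have hA : ∑ i ∈ Finset.range (2 * (j + 1)), (1 / 2 : ℝ) ^ (i / 2) = 4 - 4 * (1 / 2 : ℝ) ^ (j + 1) := by
        rw [e1, Finset.sum_range_succ, h2, show (2 * j + 1) / 2 = j by omega, pow_succ]; ring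
      refine ⟨hA, ?_⟩
      rw [Finset.sum_range_succ, hA, show 2 * (j + 1) / 2 = j + 1 by omega, pow_succ]; ring
  obtain ⟨j, hj | hj⟩ := Nat.even_or_odd' n
  · rw [hj, (key j).1]
    have : (0 : ℝ) ≤ (1 / 2 : ℝ) ^ j := by positivity
    linarith
  · rw [hj, (key j).2]
    have : (0 : ℝ) ≤ (1 / 2 : ℝ) ^ j := by positivity
    linarith

/-! ### Graham's rescaling for the short pieces -/

/-- **Short pieces** (`k ≤ 2M`; Graham's rescaling "`(C₆e⁻¹Ms)^a [x^a](Σ_{n=1}^{M} xⁿn!/Mⁿ)^N`"):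
if `f ≥ 0` vanishes off `[1, 2M]` and `f(k) ≤ Γ B^m m! s^m` with `m = ⌈k/2⌉ = (k+1)/2`, then for
`8ΓB·M·s ≤ 1`, `Σ_{a ≥ 2M} cpow f N a ≤ (24ΓB)^M M! s^M` (for every `N`; the smallness of the
rescaled one-piece sum `Σ_k f(k)ρ^k ≤ 1` at `ρ² = 1/(8ΓBMs)` makes the power `N` harmless).
[cite: Graham2010, Section 6, estimate of `A₃`] -/
theorem sum_cpow_short_le {s Γ B : ℝ} (hs : 0 < s) (hΓ : 1 ≤ Γ) (hB : 1 ≤ B) {M : ℕ} (hM : 1 ≤ M)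
    {f : ℕ → ℝ} (hf0 : ∀ k, 0 ≤ f k) (hfz : ∀ k, (k = 0 ∨ 2 * M < k) → f k = 0)
    (hfb : ∀ k, 1 ≤ k → k ≤ 2 * M →
      f k ≤ Γ * B ^ ((k + 1) / 2) * (((k + 1) / 2).factorial : ℝ) * s ^ ((k + 1) / 2))
    (hsmall : 8 * Γ * B * M * s ≤ 1) (N lo hi : ℕ) (hlo : 2 * M ≤ lo) :
    ∑ a ∈ Finset.Icc lo hi, cpow f N a ≤ (24 * Γ * B) ^ M * (M.factorial : ℝ) * s ^ M := by
  -- the Chernoff parameter `ρ`, `ρ² = 1/t`, `t = 8ΓBMs ∈ (0, 1]`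
  set t : ℝ := 8 * Γ * B * M * s with ht
  have hM' : (1 : ℝ) ≤ M := by exact_mod_cast hM
  have ht0 : 0 < t := by rw [ht]; positivity
  have ht1 : t ≤ 1 := hsmall
  set ρ : ℝ := Real.sqrt (1 / t) with hρ
  have hρsq : ρ ^ 2 = 1 / t := by rw [hρ, Real.sq_sqrt (by positivity)]
  have hρ1 : 1 ≤ ρ := by
    rw [hρ, Real.le_sqrt (by norm_num) (by positivity), one_pow, le_div_iff₀ ht0]; linarith
  have hρ0 : 0 ≤ ρ := zero_le_one.trans hρ1
  have htρ : t * ρ ^ 2 = 1 := by rw [hρsq]; field_simp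
  -- the rescaled one-piece sum is at most `1`
  have hterm : ∀ k, f k * ρ ^ k ≤ (1 / 2 : ℝ) ^ (k + 1) := by
    intro k
    rcases Nat.eq_zero_or_pos k with rfl | hk
    · rw [hfz 0 (Or.inl rfl)]; norm_num
    by_cases hkM' : 2 * M < k
    · rw [hfz k (Or.inr hkM'), zero_mul]; positivity
    have hkM : k ≤ 2 * M := Nat.le_of_not_lt hkM'
    set m := (k + 1) / 2 with hm
    have hm1 : 1 ≤ m := by omega
    have hmM : m ≤ M := by omega
    have hk2m : k ≤ 2 * m := by omega
    -- `f k ρ^k ≤ Γ B^m m! s^m ρ^{2m} = Γ (B s ρ²)^m m! = Γ (1/(8ΓM))^m m!`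
    have h1 : f k * ρ ^ k ≤ Γ * B ^ m * (m.factorial : ℝ) * s ^ m * ρ ^ (2 * m) := by
      have := hfb k hk hkM
      calc f k * ρ ^ k ≤ (Γ * B ^ m * (m.factorial : ℝ) * s ^ m) * ρ ^ k :=
            mul_le_mul_of_nonneg_right this (by positivity)
        _ ≤ (Γ * B ^ m * (m.factorial : ℝ) * s ^ m) * ρ ^ (2 * m) := by
            refine mul_le_mul_of_nonneg_left (pow_le_pow_right₀ hρ1 hk2m) ?_
            have : 0 ≤ Γ := zero_le_one.trans hΓ
            positivity
    have h2 : Γ * B ^ m * (m.factorial : ℝ) * s ^ m * ρ ^ (2 * m) = Γ * (m.factorial : ℝ) / (M : ℝ) ^ m * (1 / (8 * Γ)) ^ m := by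
      have e : B * s * ρ ^ 2 = 1 / (8 * Γ * M) := by
        rw [hρsq, ht]; field_simp
      calc Γ * B ^ m * (m.factorial : ℝ) * s ^ m * ρ ^ (2 * m)
          = Γ * (m.factorial : ℝ) * (B * s * ρ ^ 2) ^ m := by rw [pow_mul]; ring
        _ = Γ * (m.factorial : ℝ) * (1 / (8 * Γ * M)) ^ m := by rw [e]
        _ = Γ * (m.factorial : ℝ) / (M : ℝ) ^ m * (1 / (8 * Γ)) ^ m := by
            rw [show (1 / (8 * Γ * (M : ℝ))) = (1 / (8 * Γ)) / (M : ℝ) by field_simp, div_pow]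
            ring
    -- `m!/M^m ≤ 1`, `Γ (1/(8Γ))^m ≤ (1/8)^m`, `(1/8)^m ≤ (1/2)^{k+1}`
    have h3 : (m.factorial : ℝ) / (M : ℝ) ^ m ≤ 1 := by
      rw [div_le_one (by positivity)]; exact factorial_le_pow_of_le hmM
    have h4 : Γ * (1 / (8 * Γ)) ^ m ≤ (1 / 8 : ℝ) ^ m := by
      have hΓ0 : 0 < Γ := lt_of_lt_of_le one_pos hΓ
      rw [show (1 / (8 * Γ)) = (1 / 8 : ℝ) * Γ⁻¹ by field_simp, mul_pow, inv_pow]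
      have hle : Γ ≤ Γ ^ m := le_self_pow₀ hΓ (by omega)
      calc Γ * ((1 / 8 : ℝ) ^ m * (Γ ^ m)⁻¹) = (1 / 8 : ℝ) ^ m * (Γ / Γ ^ m) := by ring
        _ ≤ (1 / 8 : ℝ) ^ m * 1 := by
            refine mul_le_mul_of_nonneg_left ?_ (by positivity)
            rw [div_le_one (by positivity)]; exact hle
        _ = (1 / 8 : ℝ) ^ m := mul_one _
    have h5 : (1 / 8 : ℝ) ^ m ≤ (1 / 2 : ℝ) ^ (k + 1) := by
      rw [show (1 / 8 : ℝ) = (1 / 2) ^ 3 by norm_num, ← pow_mul]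
      exact pow_le_pow_of_le_one (by norm_num) (by norm_num) (by omega)
    calc f k * ρ ^ k ≤ Γ * B ^ m * (m.factorial : ℝ) * s ^ m * ρ ^ (2 * m) := h1
      _ = Γ * (m.factorial : ℝ) / (M : ℝ) ^ m * (1 / (8 * Γ)) ^ m := h2
      _ = (m.factorial : ℝ) / (M : ℝ) ^ m * (Γ * (1 / (8 * Γ)) ^ m) := by ring
      _ ≤ 1 * (1 / 8 : ℝ) ^ m := by
          refine mul_le_mul h3 h4 ?_ zero_le_one
          have : 0 ≤ Γ := zero_le_one.trans hΓ
          positivity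
      _ ≤ (1 / 2 : ℝ) ^ (k + 1) := by rw [one_mul]; exact h5
  have hG : ∑ k ∈ Finset.range (2 * M + 1), f k * ρ ^ k ≤ 1 :=
    (Finset.sum_le_sum fun k _ => hterm k).trans (sum_half_pow_succ_le _)
  have hG0 : 0 ≤ ∑ k ∈ Finset.range (2 * M + 1), f k * ρ ^ k :=
    Finset.sum_nonneg fun k _ => mul_nonneg (hf0 k) (by positivity)
  -- Chernoff: `cpow f N a ≤ t^M ρ^a cpow f N a` for `a ≥ 2M`
  set L := max hi (N * (2 * M)) with hL
  have hfz' : ∀ k, 2 * M < k → f k = 0 := fun k hk => hfz k (Or.inr hk)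
  calc ∑ a ∈ Finset.Icc lo hi, cpow f N a
      ≤ ∑ a ∈ Finset.Icc lo hi, t ^ M * (ρ ^ a * cpow f N a) := by
        refine Finset.sum_le_sum fun a ha => ?_
        rw [Finset.mem_Icc] at ha
        have hc : 0 ≤ cpow f N a := cpow_nonneg' hf0 N a
        have hρa : ρ ^ (2 * M) ≤ ρ ^ a := pow_le_pow_right₀ hρ1 (by omega)
        calc cpow f N a = (t * ρ ^ 2) ^ M * cpow f N a := by rw [htρ, one_pow, one_mul]
          _ = t ^ M * (ρ ^ (2 * M) * cpow f N a) := by rw [mul_pow, ← pow_mul]; ring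
          _ ≤ t ^ M * (ρ ^ a * cpow f N a) := by
              exact mul_le_mul_of_nonneg_left (mul_le_mul_of_nonneg_right hρa hc) (by positivity)
    _ = t ^ M * ∑ a ∈ Finset.Icc lo hi, ρ ^ a * cpow f N a := by rw [Finset.mul_sum]
    _ ≤ t ^ M * ∑ a ∈ Finset.range (L + 1), ρ ^ a * cpow f N a := by
        refine mul_le_mul_of_nonneg_left ?_ (by positivity)
        refine Finset.sum_le_sum_of_subset_of_nonneg (fun a ha => ?_) fun a _ _ =>
          mul_nonneg (by positivity) (cpow_nonneg' hf0 N a)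
        rw [Finset.mem_Icc] at ha; rw [Finset.mem_range]; omega
    _ = t ^ M * (∑ k ∈ Finset.range (2 * M + 1), f k * ρ ^ k) ^ N := by
        congr 1
        rw [← sum_cpow_eq_pow (f := fun k => f k * ρ ^ k) (K := 2 * M)
          (fun k hk => by simp [hfz' k hk]) N L (le_max_right _ _)]
        exact Finset.sum_congr rfl fun a _ => (cpow_mul_pow f ρ N a).symm
    _ ≤ t ^ M * 1 := mul_le_mul_of_nonneg_left (pow_le_one₀ hG0 hG) (by positivity)
    _ ≤ (24 * Γ * B) ^ M * (M.factorial : ℝ) * s ^ M := by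
        rw [mul_one, ht]
        have hMM : ((M : ℝ)) ^ M ≤ (3 : ℝ) ^ M * (M.factorial : ℝ) := pow_self_le_three_pow_mul_factorial M
        have hΓ0 : 0 ≤ Γ := zero_le_one.trans hΓ
        have hB0 : 0 ≤ B := zero_le_one.trans hB
        calc (8 * Γ * B * (M : ℝ) * s) ^ M = (8 * Γ * B) ^ M * (M : ℝ) ^ M * s ^ M := by
              rw [mul_pow, mul_pow]
          _ ≤ (8 * Γ * B) ^ M * ((3 : ℝ) ^ M * (M.factorial : ℝ)) * s ^ M := by gcongr
          _ = (24 * Γ * B) ^ M * (M.factorial : ℝ) * s ^ M := by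
              rw [show (24 : ℝ) * Γ * B = 3 * (8 * Γ * B) by ring, mul_pow (3 : ℝ)]; ring

/-! ### Medium pieces: one piece past `2M` -/

/-- **Diagrams with a piece longer than the short range**: for `0 ≤ f_s ≤ f` vanishing beyond
`K`, `Σ_a (cpow f N a - cpow f_s N a) ≤ N · (F - F_s) · F^{N-1}` with `F = Σ_k f k`,
`F_s = Σ_k f_s k` (the compositions with at least one coefficient from `f - f_s`).
[cite: Graham2010, Section 6, estimate of `A₃`] -/
theorem sum_cpow_sub_le {f fs : ℕ → ℝ} (hfs0 : ∀ k, 0 ≤ fs k) (hfs : ∀ k, fs k ≤ f k) {K : ℕ}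
    (hfK : ∀ k, K < k → f k = 0) (N lo hi : ℕ) :
    ∑ a ∈ Finset.Icc lo hi, (cpow f N a - cpow fs N a) ≤
      N * ((∑ k ∈ Finset.range (K + 1), f k) - ∑ k ∈ Finset.range (K + 1), fs k) *
        (∑ k ∈ Finset.range (K + 1), f k) ^ (N - 1) := by
  have hf0 : ∀ k, 0 ≤ f k := fun k => (hfs0 k).trans (hfs k)
  have hfsK : ∀ k, K < k → fs k = 0 := fun k hk => le_antisymm (by rw [← hfK k hk]; exact hfs k) (hfs0 k)
  have hmono : ∀ a, cpow fs N a ≤ cpow f N a := fun a => cpow_mono hfs0 hfs N a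
  set L := max hi (N * K) with hL
  calc ∑ a ∈ Finset.Icc lo hi, (cpow f N a - cpow fs N a)
      ≤ ∑ a ∈ Finset.range (L + 1), (cpow f N a - cpow fs N a) := by
        refine Finset.sum_le_sum_of_subset_of_nonneg (fun a ha => ?_) fun a _ _ => sub_nonneg.2 (hmono a)
        rw [Finset.mem_Icc] at ha; rw [Finset.mem_range]; omega
    _ = (∑ k ∈ Finset.range (K + 1), f k) ^ N - (∑ k ∈ Finset.range (K + 1), fs k) ^ N := by
        rw [Finset.sum_sub_distrib, sum_cpow_eq_pow hfK N L (le_max_right _ _),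
          sum_cpow_eq_pow hfsK N L (le_max_right _ _)]
    _ ≤ _ := pow_sub_pow_le (Finset.sum_nonneg fun k _ => hfs0 k) (Finset.sum_le_sum fun k _ => hfs k) N

/-- The one-piece sums under the factorial bound: if `f(k) ≤ Γ B^m m! s^m` (`m = (k+1)/2`) for
`1 ≤ k ≤ K₀`, `f` vanishes off `[1, K₀]`, and `B(K₀ + 2)s ≤ 1` (ratio `≤ ½`), then
`Σ_{k > 2M₀} f k ≤ 4Γ B^{M₀+1}(M₀+1)! s^{M₀+1}` for every `M₀` (`M₀ = 0`: the full sum is `≤ 4ΓBs`).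
[cite: Graham2010, Section 6, estimate of `A₃`] -/
theorem sum_tail_le {s Γ B : ℝ} (hs : 0 < s) (hΓ : 0 ≤ Γ) (hB : 0 ≤ B) {K₀ : ℕ} {f : ℕ → ℝ}
    (hfb : ∀ k, 1 ≤ k → k ≤ K₀ →
      f k ≤ Γ * B ^ ((k + 1) / 2) * (((k + 1) / 2).factorial : ℝ) * s ^ ((k + 1) / 2))
    (hratio : B * (K₀ + 2) * s ≤ 1) (M₀ : ℕ) :
    ∑ k ∈ Finset.range (K₀ + 1), (if 2 * M₀ < k then f k else 0) ≤
      4 * Γ * (B ^ (M₀ + 1) * ((M₀ + 1).factorial : ℝ) * s ^ (M₀ + 1)) := by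
  -- termwise: for `k > 2M₀`, `f k ≤ Γ B^{M₀+1}(M₀+1)! s^{M₀+1} (1/2)^{(k - 2M₀ - 1)/2}`
  have hj : ∀ j : ℕ, M₀ + 1 < j → j ≤ (K₀ + 1) / 2 → B * j * s ≤ 1 / 2 := by
    intro j _ hj2
    have : (2 : ℝ) * j ≤ K₀ + 2 := by
      have : 2 * j ≤ K₀ + 2 := by omega
      exact_mod_cast this
    nlinarith [mul_nonneg hB hs.le]
  have hterm : ∀ k ∈ Finset.range (K₀ + 1), (if 2 * M₀ < k then f k else 0) ≤
      Γ * (B ^ (M₀ + 1) * ((M₀ + 1).factorial : ℝ) * s ^ (M₀ + 1)) * (1 / 2 : ℝ) ^ ((k - (2 * M₀ + 1)) / 2) := by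
    intro k hk
    rw [Finset.mem_range] at hk
    split_ifs with hkM
    · set m := (k + 1) / 2 with hm
      have hm1 : M₀ + 1 ≤ m := by omega
      have h1 := hfb k (by omega) (by omega)
      have h2 := pow_factorial_pow_le hB hs.le (M₀ + 1) m hm1 (fun j hj1 hj2 => hj j hj1 (by omega))
      have hexp : m - (M₀ + 1) = (k - (2 * M₀ + 1)) / 2 := by omega
      rw [hexp] at h2
      calc f k ≤ Γ * B ^ m * (m.factorial : ℝ) * s ^ m := h1
        _ = Γ * (B ^ m * (m.factorial : ℝ) * s ^ m) := by ring
        _ ≤ Γ * (B ^ (M₀ + 1) * ((M₀ + 1).factorial : ℝ) * s ^ (M₀ + 1) * (1 / 2 : ℝ) ^ ((k - (2 * M₀ + 1)) / 2)) :=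
            mul_le_mul_of_nonneg_left h2 hΓ
        _ = _ := by ring
    · positivity
  -- reindex `k = 2M₀ + 1 + i` and sum the geometric factors (`≤ 4`)
  set X : ℝ := B ^ (M₀ + 1) * ((M₀ + 1).factorial : ℝ) * s ^ (M₀ + 1) with hX
  have hX0 : 0 ≤ X := by positivity
  have hfilter : (Finset.range (K₀ + 1)).filter (fun k => 2 * M₀ < k) = Finset.Ico (2 * M₀ + 1) (K₀ + 1) := by
    ext k; simp only [Finset.mem_filter, Finset.mem_range, Finset.mem_Ico]; omega
  calc ∑ k ∈ Finset.range (K₀ + 1), (if 2 * M₀ < k then f k else 0)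
      = ∑ k ∈ Finset.Ico (2 * M₀ + 1) (K₀ + 1), f k := by rw [← Finset.sum_filter, hfilter]
    _ = ∑ i ∈ Finset.range (K₀ + 1 - (2 * M₀ + 1)), f (2 * M₀ + 1 + i) := Finset.sum_Ico_eq_sum_range _ _ _
    _ ≤ ∑ i ∈ Finset.range (K₀ + 1 - (2 * M₀ + 1)), Γ * X * (1 / 2 : ℝ) ^ (i / 2) := by
        refine Finset.sum_le_sum fun i hi => ?_
        rw [Finset.mem_range] at hi
        have h := hterm (2 * M₀ + 1 + i) (Finset.mem_range.2 (by omega))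
        rw [if_pos (by omega), show 2 * M₀ + 1 + i - (2 * M₀ + 1) = i by omega] at h
        exact h
    _ = Γ * X * ∑ i ∈ Finset.range (K₀ + 1 - (2 * M₀ + 1)), (1 / 2 : ℝ) ^ (i / 2) := by rw [Finset.mul_sum]
    _ ≤ Γ * X * 4 := mul_le_mul_of_nonneg_left (sum_half_pow_div_two_le _) (by positivity)
    _ = 4 * Γ * X := by ring

/-- **Short and medium pieces together** (the class `A₃` with all pieces `≤ K₀`): under the
factorial bound on `[1, K₀]`, `8ΓB·M·s ≤ 1` and `B(K₀+2)s ≤ 1`, for every type `N ≥ 1`,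
`Σ_{a=2M}^{hi} cpow f N a ≤ (24ΓB)^M M! s^M + 4NΓ B^{M+1}(M+1)! s^{M+1}`.
[cite: Graham2010, Section 6, estimate of `A₃`] -/
theorem shortPieces_bound {s Γ B : ℝ} (hs : 0 < s) (hΓ : 1 ≤ Γ) (hB : 1 ≤ B) {M K₀ : ℕ} (hM : 1 ≤ M)
    {f : ℕ → ℝ} (hf0 : ∀ k, 0 ≤ f k) (hfz : ∀ k, (k = 0 ∨ K₀ < k) → f k = 0)
    (hfb : ∀ k, 1 ≤ k → k ≤ K₀ →
      f k ≤ Γ * B ^ ((k + 1) / 2) * (((k + 1) / 2).factorial : ℝ) * s ^ ((k + 1) / 2))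
    (hsmall : 8 * Γ * B * M * s ≤ 1) (hratio : B * (K₀ + 2) * s ≤ 1) {N : ℕ} (hN : 1 ≤ N) (hi : ℕ) :
    ∑ a ∈ Finset.Icc (2 * M) hi, cpow f N a ≤
      (24 * Γ * B) ^ M * (M.factorial : ℝ) * s ^ M +
        4 * N * Γ * (B ^ (M + 1) * ((M + 1).factorial : ℝ) * s ^ (M + 1)) := by
  have hΓ0 : 0 ≤ Γ := zero_le_one.trans hΓ
  have hB0 : 0 ≤ B := zero_le_one.trans hB
  -- the short part `f_s = f · 𝟙[k ≤ 2M]`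
  set fs : ℕ → ℝ := fun k => if k ≤ 2 * M then f k else 0 with hfs
  have hfs0 : ∀ k, 0 ≤ fs k := by intro k; simp only [hfs]; split_ifs; exacts [hf0 k, le_rfl]
  have hfsf : ∀ k, fs k ≤ f k := by intro k; simp only [hfs]; split_ifs; exacts [le_rfl, hf0 k]
  have hfsz : ∀ k, (k = 0 ∨ 2 * M < k) → fs k = 0 := by
    intro k hk
    simp only [hfs]
    rcases hk with rfl | hk
    · rw [if_pos (Nat.zero_le _)]; exact hfz 0 (Or.inl rfl)
    · rw [if_neg (by omega)]
  have hfsb : ∀ k, 1 ≤ k → k ≤ 2 * M →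
      fs k ≤ Γ * B ^ ((k + 1) / 2) * (((k + 1) / 2).factorial : ℝ) * s ^ ((k + 1) / 2) := by
    intro k hk1 hk2
    simp only [hfs, if_pos hk2]
    by_cases hkK : k ≤ K₀
    · exact hfb k hk1 hkK
    · rw [hfz k (Or.inr (by omega))]; positivity
  have hshort := sum_cpow_short_le hs hΓ hB hM hfs0 hfsz hfsb hsmall N (2 * M) hi le_rfl
  -- the medium part
  have hfK : ∀ k, K₀ < k → f k = 0 := fun k hk => hfz k (Or.inr hk)
  have hmed := sum_cpow_sub_le hfs0 hfsf hfK N (2 * M) hi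
  -- `F ≤ 4ΓBs ≤ 1` and `F - F_s = Σ_{k > 2M} f k ≤ 4Γ B^{M+1}(M+1)! s^{M+1}`
  have hF : ∑ k ∈ Finset.range (K₀ + 1), f k ≤ 4 * Γ * (B ^ (0 + 1) * ((0 + 1).factorial : ℝ) * s ^ (0 + 1)) := by
    have h := sum_tail_le hs hΓ0 hB0 hfb hratio 0
    refine (le_of_eq (Finset.sum_congr rfl fun k hk => ?_)).trans h
    rcases Nat.eq_zero_or_pos k with rfl | hk0
    · rw [if_neg (by omega), hfz 0 (Or.inl rfl)]
    · rw [if_pos (by omega)]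
  have hF1 : ∑ k ∈ Finset.range (K₀ + 1), f k ≤ 1 := by
    refine hF.trans ?_
    simp only [zero_add, Nat.factorial_one, Nat.cast_one, mul_one, pow_one]
    have hM' : (1 : ℝ) ≤ M := by exact_mod_cast hM
    nlinarith [mul_nonneg (mul_nonneg hΓ0 hB0) hs.le]
  have hF0 : 0 ≤ ∑ k ∈ Finset.range (K₀ + 1), f k := Finset.sum_nonneg fun k _ => hf0 k
  have hFm : (∑ k ∈ Finset.range (K₀ + 1), f k) - ∑ k ∈ Finset.range (K₀ + 1), fs k ≤
      4 * Γ * (B ^ (M + 1) * ((M + 1).factorial : ℝ) * s ^ (M + 1)) := by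
    rw [← Finset.sum_sub_distrib]
    have h := sum_tail_le hs hΓ0 hB0 hfb hratio M
    refine (le_of_eq (Finset.sum_congr rfl fun k _ => ?_)).trans h
    simp only [hfs]
    by_cases hk : k ≤ 2 * M
    · rw [if_pos hk, if_neg (by omega), sub_self]
    · rw [if_neg hk, if_pos (by omega), sub_zero]
  have hFm0 : 0 ≤ (∑ k ∈ Finset.range (K₀ + 1), f k) - ∑ k ∈ Finset.range (K₀ + 1), fs k := by
    rw [← Finset.sum_sub_distrib]; exact Finset.sum_nonneg fun k _ => sub_nonneg.2 (hfsf k)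
  -- assemble
  have hsplit : ∑ a ∈ Finset.Icc (2 * M) hi, cpow f N a =
      ∑ a ∈ Finset.Icc (2 * M) hi, cpow fs N a + ∑ a ∈ Finset.Icc (2 * M) hi, (cpow f N a - cpow fs N a) := by
    rw [← Finset.sum_add_distrib]; exact Finset.sum_congr rfl fun a _ => by ring
  rw [hsplit]
  refine add_le_add hshort (hmed.trans ?_)
  calc (N : ℝ) * ((∑ k ∈ Finset.range (K₀ + 1), f k) - ∑ k ∈ Finset.range (K₀ + 1), fs k) *
        (∑ k ∈ Finset.range (K₀ + 1), f k) ^ (N - 1)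
      ≤ (N : ℝ) * (4 * Γ * (B ^ (M + 1) * ((M + 1).factorial : ℝ) * s ^ (M + 1))) * 1 := by
        refine mul_le_mul (mul_le_mul_of_nonneg_left hFm (Nat.cast_nonneg _)) (pow_le_one₀ hF0 hF1)
          (by positivity) (by positivity)
    _ = 4 * N * Γ * (B ^ (M + 1) * ((M + 1).factorial : ℝ) * s ^ (M + 1)) := by ring

/-- **The sum over the types** `N = 1, …, M`:
`Σ_{N=1}^{M} Σ_{a=2M}^{hi} cpow f N a ≤ (48ΓB)^{M+1} (M+1)! s^M` (Graham: "`≤ ¼ s^M C₆^{M+1}(M+1)!`").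
[cite: Graham2010, Section 6, estimate of `A₃`] -/
theorem sum_shortPieces_bound {s Γ B : ℝ} (hs : 0 < s) (hΓ : 1 ≤ Γ) (hB : 1 ≤ B)
    {M K₀ : ℕ} (hM : 1 ≤ M) {f : ℕ → ℝ} (hf0 : ∀ k, 0 ≤ f k) (hfz : ∀ k, (k = 0 ∨ K₀ < k) → f k = 0)
    (hfb : ∀ k, 1 ≤ k → k ≤ K₀ →
      f k ≤ Γ * B ^ ((k + 1) / 2) * (((k + 1) / 2).factorial : ℝ) * s ^ ((k + 1) / 2))
    (hsmall : 8 * Γ * B * M * s ≤ 1) (hratio : B * (K₀ + 2) * s ≤ 1) (hi : ℕ) :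
    ∑ N ∈ Finset.Icc 1 M, ∑ a ∈ Finset.Icc (2 * M) hi, cpow f N a ≤
      (48 * Γ * B) ^ (M + 1) * ((M + 1).factorial : ℝ) * s ^ M := by
  have hΓ0 : 0 ≤ Γ := zero_le_one.trans hΓ
  have hB0 : 0 ≤ B := zero_le_one.trans hB
  have hM' : (1 : ℝ) ≤ M := by exact_mod_cast hM
  set X : ℝ := (24 * Γ * B) ^ M * (M.factorial : ℝ) * s ^ M with hX
  set Y : ℝ := 4 * Γ * (B ^ (M + 1) * ((M + 1).factorial : ℝ) * s ^ (M + 1)) with hY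
  have hX0 : 0 ≤ X := by positivity
  have hY0 : 0 ≤ Y := by positivity
  calc ∑ N ∈ Finset.Icc 1 M, ∑ a ∈ Finset.Icc (2 * M) hi, cpow f N a
      ≤ ∑ N ∈ Finset.Icc 1 M, (X + (N : ℝ) * Y) := by
        refine Finset.sum_le_sum fun N hN => ?_
        rw [Finset.mem_Icc] at hN
        have h := shortPieces_bound hs hΓ hB hM hf0 hfz hfb hsmall hratio hN.1 hi
        rw [hX, hY]; linarith
    _ ≤ ∑ _N ∈ Finset.Icc 1 M, (X + (M : ℝ) * Y) := by
        refine Finset.sum_le_sum fun N hN => ?_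
        rw [Finset.mem_Icc] at hN
        have : (N : ℝ) ≤ M := by exact_mod_cast hN.2
        nlinarith
    _ = (M : ℝ) * (X + (M : ℝ) * Y) := by
        rw [Finset.sum_const, Nat.card_Icc, show M + 1 - 1 = M by omega, nsmul_eq_mul]
    _ ≤ (48 * Γ * B) ^ (M + 1) * ((M + 1).factorial : ℝ) * s ^ M := by
        set C : ℝ := 24 * Γ * B with hC
        have hC1 : 1 ≤ C := by rw [hC]; nlinarith
        have hC0 : 0 ≤ C := zero_le_one.trans hC1
        have hfac : (M : ℝ) * (M.factorial : ℝ) ≤ ((M + 1).factorial : ℝ) := by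
          rw [Nat.factorial_succ, Nat.cast_mul]
          push_cast
          have h0 : (0 : ℝ) ≤ (M.factorial : ℝ) := Nat.cast_nonneg _
          nlinarith
        have hMs : (M : ℝ) * s ≤ 1 := by nlinarith [mul_nonneg (mul_nonneg hΓ0 hB0) hs.le]
        have hM2 : (M : ℝ) ≤ (2 : ℝ) ^ M := by exact_mod_cast Nat.lt_two_pow_self.le
        -- `M·X ≤ C^M (M+1)! s^M`
        have hA : (M : ℝ) * X ≤ C ^ M * ((M + 1).factorial : ℝ) * s ^ M := by
          rw [hX]
          calc (M : ℝ) * (C ^ M * (M.factorial : ℝ) * s ^ M) = C ^ M * ((M : ℝ) * (M.factorial : ℝ)) * s ^ M := by ring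
            _ ≤ C ^ M * ((M + 1).factorial : ℝ) * s ^ M := by gcongr
        -- `M·(M·Y) ≤ C^{M+1} (M+1)! s^M`
        have hkey : 4 * Γ * B ^ (M + 1) * (2 : ℝ) ^ M ≤ C ^ (M + 1) := by
          have h1 : (2 : ℝ) ^ M ≤ (24 : ℝ) ^ M := pow_le_pow_left₀ (by norm_num) (by norm_num) M
          have h2 : Γ ≤ Γ ^ (M + 1) := le_self_pow₀ hΓ (by omega)
          calc 4 * Γ * B ^ (M + 1) * (2 : ℝ) ^ M ≤ 4 * Γ ^ (M + 1) * B ^ (M + 1) * (24 : ℝ) ^ M := by gcongr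
            _ ≤ 24 * Γ ^ (M + 1) * B ^ (M + 1) * (24 : ℝ) ^ M := by gcongr; norm_num
            _ = C ^ (M + 1) := by rw [hC, mul_pow, mul_pow, pow_succ (24 : ℝ)]; ring
        have hBsum : (M : ℝ) * ((M : ℝ) * Y) ≤ C ^ (M + 1) * ((M + 1).factorial : ℝ) * s ^ M := by
          rw [hY]
          calc (M : ℝ) * ((M : ℝ) * (4 * Γ * (B ^ (M + 1) * ((M + 1).factorial : ℝ) * s ^ (M + 1))))
              = 4 * Γ * B ^ (M + 1) * ((M : ℝ) * ((M : ℝ) * s)) * (((M + 1).factorial : ℝ) * s ^ M) := by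
                rw [pow_succ]; ring
            _ ≤ 4 * Γ * B ^ (M + 1) * ((2 : ℝ) ^ M * 1) * (((M + 1).factorial : ℝ) * s ^ M) := by gcongr
            _ = (4 * Γ * B ^ (M + 1) * (2 : ℝ) ^ M) * (((M + 1).factorial : ℝ) * s ^ M) := by ring
            _ ≤ C ^ (M + 1) * (((M + 1).factorial : ℝ) * s ^ M) :=
                mul_le_mul_of_nonneg_right hkey (by positivity)
            _ = C ^ (M + 1) * ((M + 1).factorial : ℝ) * s ^ M := by ring
        have hCM : C ^ M ≤ C ^ (M + 1) := pow_le_pow_right₀ hC1 (Nat.le_succ M)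
        have h2C : (2 : ℝ) * C ^ (M + 1) ≤ (48 * Γ * B) ^ (M + 1) := by
          have e : (48 : ℝ) * Γ * B = 2 * C := by rw [hC]; ring
          have h2 : (2 : ℝ) ≤ 2 ^ (M + 1) := by
            calc (2 : ℝ) = 2 ^ 1 := (pow_one (2 : ℝ)).symm
              _ ≤ 2 ^ (M + 1) := pow_le_pow_right₀ (by norm_num) (by omega)
          calc (2 : ℝ) * C ^ (M + 1) ≤ 2 ^ (M + 1) * C ^ (M + 1) :=
                mul_le_mul_of_nonneg_right h2 (pow_nonneg hC0 _)
            _ = (2 * C) ^ (M + 1) := (mul_pow 2 C (M + 1)).symm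
            _ = (48 * Γ * B) ^ (M + 1) := by rw [e]
        have hnn : 0 ≤ ((M + 1).factorial : ℝ) * s ^ M := by positivity
        calc (M : ℝ) * (X + (M : ℝ) * Y) = (M : ℝ) * X + (M : ℝ) * ((M : ℝ) * Y) := by ring
          _ ≤ C ^ M * ((M + 1).factorial : ℝ) * s ^ M + C ^ (M + 1) * ((M + 1).factorial : ℝ) * s ^ M :=
              add_le_add hA hBsum
          _ ≤ C ^ (M + 1) * ((M + 1).factorial : ℝ) * s ^ M + C ^ (M + 1) * ((M + 1).factorial : ℝ) * s ^ M := by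
              gcongr
          _ = (2 * C ^ (M + 1)) * (((M + 1).factorial : ℝ) * s ^ M) := by ring
          _ ≤ (48 * Γ * B) ^ (M + 1) * (((M + 1).factorial : ℝ) * s ^ M) :=
              mul_le_mul_of_nonneg_right h2C hnn
          _ = (48 * Γ * B) ^ (M + 1) * ((M + 1).factorial : ℝ) * s ^ M := by ring

end Literature.Probability.RandomPlanarGeometry.SAW.Zd.Graham2010
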